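import Mathlib.SetTheory.Cardinal.Free
import Literature.AnabelianGeometry.SemiGraphs.TemperedSpecialFibreTowerPiDataWitness
import Literature.AnabelianGeometry.SemiGraphs.ProSigmaCompletionModels
import Literature.AnabelianGeometry.SemiGraphs.ProSigmaCompletionTFG
import Literature.IUT.HodgeTheaters.DiscreteProfiniteCompletionsAssembly
import HarnessLib

/-!
# The special-fibre tower and `SpecialFibreTower.PiData` at `Δ ≅ F̂₂`, the free profinite group of rank two
# ([SemiAnbd] Ex. 3.10 pp. 44–45 — non-vacuity at the profinite geometric fundamental group of a once-punctured
# elliptic curve)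

Mochizuki, *Semi-graphs of anabelioids*, Publ. RIMS **42** (2006), §3, Example 3.10, manuscript p. 44
[cite: MochizukiSemiAnbd2006, Ex 3.10 p.44] ("an exhaustive sequence of open characteristic … subgroups … `N_i` … `𝒢_i`,
`𝒢^c_i` … `Δ ↠ … ↠ Δ[i] ↠ …"); for a once-punctured elliptic curve `X` the profinite geometric fundamental group
`Δ̂_X` is free profinite of rank two ([SemiAnbd] Ex. 3.10 / [EtTh] §1 setting — here only the SHAPE `F̂₂ :=` the
profinite completion of the free group on two generators is used).

PROOF-ONLY file (abc-iut cell §4(iii) non-vacuity lane; seat abc-iut-L3-t2 gen 4; no definition, no instance, no named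
fact): the witnesses of `SpecialFibreTowerOfCharLevels.lean` / `TemperedSpecialFibreTowerPiDataWitness.lean`
SPECIALISED to `F̂₂` — slim (seat abc-iut-w5-d040's `isSlimGroup_profiniteCompletion_freeGroupTwo`), topologically
finitely generated (seat abc-iut-w4-d075's `IsProSigmaCompletion.isTopologicallyFinitelyGenerated_of_fg` at the full
profinite completion), second countable, infinite (`F₂ ↪ F̂₂`, free groups are residually finite):

* `SpecialFibreTower.nonempty_freeProfiniteTwo` — `F̂₂` carries a special-fibre tower whose levels are the
  CHARACTERISTIC OPEN CORES `charOpenCore F̂₂ i` (cofinal among the open subgroups of finite index), with one-vertex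
  fibres `B(N_i)`, charts `π₁^temp = N_i`, admissible kernels `1`;
* `SpecialFibreTower.PiData.exists_temperedCurve_freeProfiniteTwo` — the §6 datum `K := ℚ_p`,
  `Π^temp := G_{ℚ_p} × F̂₂` (so `Δ^temp ≅ F̂₂`, arithmetic part GENUINE) carries `GroupLevelData` and INHABITED
  `FiniteLevels` + `PiData` with those levels, for every prime `p`.

HONEST LIMITS: consistency evidence only — `Π^temp` is a direct product and profinite (a genuine `Π^tp_X` is neither:
`G_K` acts non-trivially outer on `Δ`, and `Δ^tp_X` is not compact), no closed points, one-vertex fibres, trivial graph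
actions; NOT André's `π₁^temp` of a curve and NOT the special-fibre tower of a curve.  Nothing of the paper is
asserted; no side is taken on [IUTchIII] Cor. 3.12.
-/

noncomputable section

namespace Literature.AnabelianGeometry.SemiGraphs

open Literature.AlgebraicGeometry.Frobenioids (IsSlimGroup)
open Literature.AnabelianGeometry.AbsoluteAnabelian (IsTopologicallyFinitelyGenerated)
open Literature.IUT.HodgeTheaters (profiniteCompletion toCompletion)
open ProfiniteSemiGraph Topology

/-! ### `F̂₂`: infinite, topologically finitely generated -/

/-- `F̂₂` is infinite: the free group `F₂` is infinite and injects into its profinite completion (free groups are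
residually finite, [SemiAnbd] Cor. 1.7). [cite: MochizukiSemiAnbd2006, Cor 1.7 p.20] -/
theorem infinite_profiniteCompletion_freeGroupTwo : Infinite (profiniteCompletion (FreeGroup (Fin 2))) :=
  Infinite.of_injective (toCompletion (FreeGroup (Fin 2)))
    (Literature.IUT.HodgeTheaters.FreeOrSurface.toCompletion_injective (FreeGroup (Fin 2)))

/-- `F̂₂` is topologically finitely generated (the images of the two free generators generate a dense subgroup).
[cite: MochizukiAbsTopI2012, Prop 2.2 p.18] -/
theorem isTopologicallyFinitelyGenerated_profiniteCompletion_freeGroupTwo :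
    IsTopologicallyFinitelyGenerated (profiniteCompletion (FreeGroup (Fin 2))) :=
  (SemiGraphOfAnabelioids.IsProSigmaCompletion.isProSigmaCompletion_toCompletion
    (FreeGroup (Fin 2))).isTopologicallyFinitelyGenerated_of_fg

/-! ### The tower over `F̂₂` -/

/-- **`SpecialFibreTower F̂₂` is inhabited** ([SemiAnbd] Ex. 3.10 as typed, at the free profinite group of rank two):
levels = the characteristic open cores `charOpenCore F̂₂ i` (open, normal, finite index, fixed by every bi-continuous
automorphism, COFINAL among the open finite-index subgroups), one-vertex fibres `B(N_i)`, charts `π₁^temp = N_i`,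
admissible kernels `1`, faithfulness from the slimness of `F̂₂`.  Consistency evidence only.
[cite: MochizukiSemiAnbd2006, Ex 3.10 p.44] -/
theorem SpecialFibreTower.nonempty_freeProfiniteTwo :
    ∃ T : SpecialFibreTower (profiniteCompletion (FreeGroup (Fin 2))),
      T.N = charOpenCore (profiniteCompletion (FreeGroup (Fin 2))) ∧ (∀ i, T.admKer i = ⊥) ∧
      ∀ U : Subgroup (profiniteCompletion (FreeGroup (Fin 2))),
        IsOpen (U : Set (profiniteCompletion (FreeGroup (Fin 2)))) → U.FiniteIndex → ∃ i, T.N i ≤ U := by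
  haveI : SecondCountableTopology (profiniteCompletion (FreeGroup (Fin 2))) :=
    secondCountableTopology_profiniteCompletion_freeGroup (Fin 2)
  haveI : Infinite (profiniteCompletion (FreeGroup (Fin 2))) := infinite_profiniteCompletion_freeGroupTwo
  obtain ⟨T, hN, hadm, -, -, hcof⟩ := SpecialFibreTower.exists_of_isTopologicallyFinitelyGenerated
    (Δ := profiniteCompletion (FreeGroup (Fin 2))) isSlimGroup_profiniteCompletion_freeGroupTwo
    isTopologicallyFinitelyGenerated_profiniteCompletion_freeGroupTwo
  exact ⟨T, hN, hadm, hcof⟩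

/-! ### `PiData` at `Π^temp := G_{ℚ_p} × F̂₂` -/

/-- **`SpecialFibreTower.PiData` (with `FiniteLevels`, `GroupLevelData`) INHABITED at the §6 datum
`Π^temp := G_{ℚ_p} × F̂₂`** for every prime `p`: `K := ℚ_p` (`G_K = G_{ℚ_p}` genuine), `Δ^temp ≅ F̂₂` (the SHAPE of
the profinite geometric fundamental group of a once-punctured elliptic curve), no closed points; tower levels = the
transported characteristic open cores of `F̂₂`, one-vertex fibres, admissible kernels `1`
(`PiData.exists_temperedCurve_of_isTopologicallyFinitelyGenerated`).  Consistency evidence only; not a curve.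
[cite: MochizukiSemiAnbd2006, Ex 3.10 p.44] -/
theorem SpecialFibreTower.PiData.exists_temperedCurve_freeProfiniteTwo (p : ℕ) [Fact p.Prime] :
    ∃ (X : TemperedCurve p) (d : X.GroupLevelData) (S : SpecialFibreData (X.toTemperedArithmeticGroup d))
      (T : SpecialFibreTower X.DeltaTemp),
      X.K = ⊥ ∧ Function.Surjective X.aug ∧ IsEmpty X.Pt ∧
        (∃ e : profiniteCompletion (FreeGroup (Fin 2)) ≃ₜ* X.DeltaTemp, ∀ i,
          T.N i = (charOpenCore (profiniteCompletion (FreeGroup (Fin 2))) i).map e.toMulEquiv.toMonoidHom) ∧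
        (∀ i, T.admKer i = ⊥) ∧ FiniteLevels X d S T ∧ Nonempty (PiData X d S T) := by
  haveI : SecondCountableTopology (profiniteCompletion (FreeGroup (Fin 2))) :=
    secondCountableTopology_profiniteCompletion_freeGroup (Fin 2)
  haveI : Infinite (profiniteCompletion (FreeGroup (Fin 2))) := infinite_profiniteCompletion_freeGroupTwo
  exact PiData.exists_temperedCurve_of_isTopologicallyFinitelyGenerated p (profiniteCompletion (FreeGroup (Fin 2)))
    isSlimGroup_profiniteCompletion_freeGroupTwo isTopologicallyFinitelyGenerated_profiniteCompletion_freeGroupTwo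

end Literature.AnabelianGeometry.SemiGraphs

end
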